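import Summits.AtomisticToContinuum.Crystallization.Theorems.ExcessDecayLiouvillePhononStabilityCertSliceRep

/-!
# Near-certificate layer V9-a: convexity splitting of the stiff scalar `ω̃` (lead c2)

Support file for crux `PhononStability` (stmt-AtomisticToContinuum-9333), line `contragredient-window-collapse`.

The curvature of the class model in the chart variables is dominated by `ω̃″(ρ) · (∂ρ)² · Z` — the stiff
bond-stretching nonlinearity seen through the affine map `x ↦ ρ_c(x)`.  Since `ω̃″ = ρ⁻¹⁰ (1008 − 240 ρ³) ≥ 0` for
`ρ³ ≤ 21/5` and the `Z`-pair form is nonnegative, `ω̃` may be replaced by its TANGENT at any reference `ρ₀` of the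
range: `ω̃(ρ₀) + ω̃′(ρ₀)(ρ − ρ₀) ≤ ω̃(ρ)` (`omegaT_tangent_le`), whence the class model dominates its tangent model
(`classModelTan_le`) — a lower bound AFFINE in `ρ` whose interpolation/robustness defect no longer contains the stiff
term (the gap is paid, rank-one along `Z`, where the certificates have slack).
-/

noncomputable section

open scoped BigOperators
open Set Function
open Summit.AtomisticToContinuum.Crystallization.Theorems.PhononStabilityNegative

namespace Summit.AtomisticToContinuum.Crystallization.Theorems.PhononStabilityCWC.Cert

local notation "E3" => EuclideanSpace ℝ (Fin 3)

/-- `ω̃″ ≥ 0` where `ρ³ ≤ 21/5`. [folklore] -/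
theorem omegaT2_nonneg {ρ : ℝ} (hρ : 0 < ρ) (h3 : ρ ^ 3 ≤ 21 / 5) : 0 ≤ omegaT2 ρ := by
  unfold omegaT2 ipc
  rw [show ((-10 : ℤ)) = -((10 : ℕ) : ℤ) by norm_num, show ((-7 : ℤ)) = -((7 : ℕ) : ℤ) by norm_num,
    zpow_neg, zpow_neg, zpow_natCast, zpow_natCast]
  have h10 : 0 < ρ ^ 10 := by positivity
  have h7 : 0 < ρ ^ 7 := by positivity
  rw [← one_div, ← one_div, mul_one_div, mul_one_div]
  rw [div_add_div _ _ h10.ne' h7.ne', le_div_iff₀ (by positivity), zero_mul]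
  have : ρ ^ 10 = ρ ^ 7 * ρ ^ 3 := by ring
  nlinarith [h7, this]

/-- `ω̃′` is monotone on a positive interval with `hi³ ≤ 21/5`. [folklore] -/
theorem omegaT1_monotoneOn {lo hi : ℝ} (hlo : 0 < lo) (hhi : hi ^ 3 ≤ 21 / 5) : MonotoneOn omegaT1 (Icc lo hi) := by
  have hderiv : ∀ x ∈ Icc lo hi, HasDerivAt omegaT1 (omegaT2 x) x :=
    fun x hx => hasDerivAt_omegaT1 (by linarith [hx.1] : x ≠ 0)
  refine monotoneOn_of_deriv_nonneg (convex_Icc lo hi)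
    (fun x hx => (hderiv x hx).continuousAt.continuousWithinAt)
    (fun x hx => (hderiv x (interior_subset hx)).differentiableAt.differentiableWithinAt) ?_
  intro x hx
  have hx' : x ∈ Icc lo hi := interior_subset hx
  rw [(hderiv x hx').deriv]
  have hxpos : 0 < x := by linarith [hx'.1]
  refine omegaT2_nonneg hxpos (le_trans ?_ hhi)
  exact pow_le_pow_left₀ hxpos.le hx'.2 3

/-- **tangent minorant of the convex `ω̃`:** `ω̃(ρ₀) + ω̃′(ρ₀)(ρ − ρ₀) ≤ ω̃(ρ)` on a positive range with
`hi³ ≤ 21/5`. [folklore] -/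
theorem omegaT_tangent_le {lo hi ρ ρ₀ : ℝ} (hlo : 0 < lo) (hhi : hi ^ 3 ≤ 21 / 5) (hρ : ρ ∈ Icc lo hi)
    (hρ₀ : ρ₀ ∈ Icc lo hi) : omegaT ρ₀ + omegaT1 ρ₀ * (ρ - ρ₀) ≤ omegaT ρ := by
  have hmono := omegaT1_monotoneOn hlo hhi
  have hder : ∀ x ∈ Icc lo hi, HasDerivAt omegaT (omegaT1 x) x :=
    fun x hx => hasDerivAt_omegaT (by linarith [hx.1] : x ≠ 0)
  have hcont : ∀ a b, Icc a b ⊆ Icc lo hi → ContinuousOn omegaT (Icc a b) :=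
    fun a b hsub x hx => (hder x (hsub hx)).continuousAt.continuousWithinAt
  have hdiff : ∀ a b, Icc a b ⊆ Icc lo hi → DifferentiableOn ℝ omegaT (interior (Icc a b)) :=
    fun a b hsub x hx => (hder x (hsub (interior_subset hx))).differentiableAt.differentiableWithinAt
  rcases le_total ρ₀ ρ with hle | hle
  · -- on `[ρ₀, ρ]` the derivative is `≥ ω̃′(ρ₀)`
    have hsub : Icc ρ₀ ρ ⊆ Icc lo hi := fun x hx => ⟨le_trans hρ₀.1 hx.1, le_trans hx.2 hρ.2⟩
    have hge : ∀ x ∈ interior (Icc ρ₀ ρ), omegaT1 ρ₀ ≤ deriv omegaT x := by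
      intro x hx
      have hx' := hsub (interior_subset hx)
      rw [(hder x hx').deriv]
      exact hmono hρ₀ hx' (interior_subset hx).1
    have := (convex_Icc ρ₀ ρ).mul_sub_le_image_sub_of_le_deriv (hcont _ _ hsub) (hdiff _ _ hsub) hge
      ρ₀ (left_mem_Icc.mpr hle) ρ (right_mem_Icc.mpr hle) hle
    linarith
  · -- on `[ρ, ρ₀]` the derivative is `≤ ω̃′(ρ₀)`
    have hsub : Icc ρ ρ₀ ⊆ Icc lo hi := fun x hx => ⟨le_trans hρ.1 hx.1, le_trans hx.2 hρ₀.2⟩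
    have hle' : ∀ x ∈ interior (Icc ρ ρ₀), deriv omegaT x ≤ omegaT1 ρ₀ := by
      intro x hx
      have hx' := hsub (interior_subset hx)
      rw [(hder x hx').deriv]
      exact hmono hx' hρ₀ (interior_subset hx).2
    have := (convex_Icc ρ ρ₀).image_sub_le_mul_sub_of_deriv_le (hcont _ _ hsub) (hdiff _ _ hsub) hle'
      ρ (left_mem_Icc.mpr hle) ρ₀ (right_mem_Icc.mpr hle) hle
    linarith

/-- the TANGENT class model: `ω̃` replaced by its tangent at `ρ₀` -/
def classModelTan (ρ₀ : ℝ) (ρbar : ℚ) (P : SPoly) (Z Λ : List (Mono × Mat)) (c : BondClass) (y : ℕ → ℝ)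
    (w : Label → E3) : ℝ :=
  (omegaT ρ₀ + omegaT1 ρ₀ * (((ρbar : ℝ) + spEval P y) - ρ₀)) * pairEvalR c (matVal y Z) w
    + psiT ((ρbar : ℝ) + spEval P y) * pairEvalR c (matVal y Λ) w

/-- **CONVEXITY SPLIT:** the class model dominates its tangent model wherever the `Z`-pair form is nonnegative and
`ρ, ρ₀` lie in a positive range with `hi³ ≤ 21/5`. [folklore] -/
theorem classModelTan_le {lo hi ρ₀ : ℝ} (hlo : 0 < lo) (hhi : hi ^ 3 ≤ 21 / 5) (hρ₀ : ρ₀ ∈ Icc lo hi)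
    (ρbar : ℚ) (P : SPoly) (Z Λ : List (Mono × Mat)) (c : BondClass) {y : ℕ → ℝ} {w : Label → E3}
    (hρ : (ρbar : ℝ) + spEval P y ∈ Icc lo hi) (hZ : 0 ≤ pairEvalR c (matVal y Z) w) :
    classModelTan ρ₀ ρbar P Z Λ c y w ≤ classModel ρbar P Z Λ c y w := by
  unfold classModelTan classModel
  have h := omegaT_tangent_le hlo hhi hρ hρ₀
  nlinarith [h, hZ]

/-- the tangent model at the tangency point is the model. [folklore] -/
theorem classModelTan_self (ρbar : ℚ) (P : SPoly) (Z Λ : List (Mono × Mat)) (c : BondClass) (y : ℕ → ℝ) (w : Label → E3) :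
    classModelTan ((ρbar : ℝ) + spEval P y) ρbar P Z Λ c y w = classModel ρbar P Z Λ c y w := by
  unfold classModelTan classModel
  ring

/-- Anchor of this support file (registered stub of the line skeleton, lead c2): the convexity threshold. -/
theorem stub_certConvexA : (0 : ℝ) ≤ omegaT2 1 := by
  refine omegaT2_nonneg one_pos ?_
  norm_num

end Summit.AtomisticToContinuum.Crystallization.Theorems.PhononStabilityCWC.Cert

end
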